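import Mathlib

/-!
# The Fubini step of the period closer's Lemmas A and D (T3.1 §3, seat t3-p1)

PERIOD.md §3 Lemma A: the wedge of two isotypic theta lifts
`θ(χ₀, φ₀) := ∫_{[U(W₀)]} χ₀(t) θ(t, φ₀) dt` and `θ(χ₁, φ₁)` is the double integral of the
wedges, `∫∫ χ₀(t₀) χ₁(t₁) · θ(t₀, φ₀) ∧ θ(t₁, φ₁) dt₀ dt₁`; Lemma D then integrates a
continuous function over the compact product `Sh(G)_K × [T × T′]` in either order.  Both are
«everything is Fubini on compact groups» and carry the label CELL in TIER3.md §3 R-A (d).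

This file records that step with its exact hypotheses, on Mathlib only: the integrands are
CONTINUOUS maps from COMPACT spaces (the adelic quotients `[U(W_i)]`, `Sh(G)_K`) carrying
FINITE measures (Haar measures of compact groups) into COMPLETE normed spaces (the
finite-dimensional spaces of `K`-invariant forms of a fixed type, or the scalars), and the wedge
is a CONTINUOUS BILINEAR map `B`.  Then

* `integral_bilin_integral`: `B (∫ f) (∫ g) = ∫ B (f z.1) (g z.2) d(μ × ν)`;
* `integral_bilin_integral_iterated`: the same as an iterated integral;
* `integral_smul_bilin_integral_smul`: the weighted form of Lemma A,
  `B (∫ χ₀ • θ₀) (∫ χ₁ • θ₁) = ∫ (χ₀ z.1 * χ₁ z.2) • B (θ₀ z.1) (θ₁ z.2) d(μ × ν)`;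
* `integral_prod_eq_iterated_of_continuous`: Lemma D's exchange of the order of integration
  for a continuous function on a compact product.

Nothing here is specific to theta series: the file declares no definition and no notation, and
it asserts nothing about the Hodge conjecture, which is NOT proved by anyone in this repository.
-/

namespace HodgeRepro.T3P1.WedgeFubini

open MeasureTheory

variable {X Y : Type*} [TopologicalSpace X] [MeasurableSpace X] [OpensMeasurableSpace X]
  [CompactSpace X] [TopologicalSpace Y] [MeasurableSpace Y] [OpensMeasurableSpace Y]
  [CompactSpace Y]
variable {μ : Measure X} {ν : Measure Y} [IsFiniteMeasure μ] [IsFiniteMeasure ν]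

section integrable

variable {E : Type*} [NormedAddCommGroup E]

/-- A continuous map from a compact space into a normed group is integrable for every finite
measure (it is bounded and has compact support). -/
theorem integrable_of_continuous {f : X → E} (hf : Continuous f) : Integrable f μ :=
  hf.integrable_of_hasCompactSupport (HasCompactSupport.of_compactSpace f)

end integrable

section integrand

variable {𝕜 : Type*} [RCLike 𝕜]
variable {E F G : Type*} [NormedAddCommGroup E] [NormedSpace 𝕜 E] [NormedAddCommGroup F]
  [NormedSpace 𝕜 F] [NormedAddCommGroup G] [NormedSpace 𝕜 G]

/-- The integrand `z ↦ B (f z.1) (g z.2)` of Lemma A is integrable on the product (no topology on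
the product is needed: the bound `‖B u v‖ ≤ ‖B‖ ‖u‖ ‖v‖` and the integrability of each factor). -/
theorem integrable_bilin_prod (B : E →L[𝕜] F →L[𝕜] G) {f : X → E} {g : Y → F}
    (hf : Continuous f) (hg : Continuous g) :
    Integrable (fun z : X × Y => B (f z.1) (g z.2)) (μ.prod ν) :=
  (integrable_of_continuous hf).op_fst_snd (by fun_prop) ⟨‖B‖, B.le_opNorm₂⟩
    (integrable_of_continuous hg)

end integrand

section bilinear

variable {𝕜 : Type*} [RCLike 𝕜]
variable {E F G : Type*}
  [NormedAddCommGroup E] [NormedSpace ℝ E] [NormedSpace 𝕜 E] [CompleteSpace E]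
  [NormedAddCommGroup F] [NormedSpace ℝ F] [NormedSpace 𝕜 F] [CompleteSpace F]
  [NormedAddCommGroup G] [NormedSpace ℝ G] [NormedSpace 𝕜 G] [CompleteSpace G]

/-- THE FUBINI STEP OF LEMMA A. For continuous `f`, `g` on compact spaces with finite measures
and a continuous bilinear `B` (the wedge product on the finite-dimensional spaces of forms),
`B (∫ f dμ) (∫ g dν) = ∫ B (f z.1) (g z.2) d(μ × ν)`. -/
theorem integral_bilin_integral (B : E →L[𝕜] F →L[𝕜] G) {f : X → E} {g : Y → F}
    (hf : Continuous f) (hg : Continuous g) :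
    B (∫ x, f x ∂μ) (∫ y, g y ∂ν) = ∫ z, B (f z.1) (g z.2) ∂μ.prod ν :=
  (integral_prod_bilin B (integrable_of_continuous hf) (integrable_of_continuous hg)).symm

/-- Lemma A as an iterated integral: `B (∫ f) (∫ g) = ∫ x, ∫ y, B (f x) (g y) dν dμ`. -/
theorem integral_bilin_integral_iterated (B : E →L[𝕜] F →L[𝕜] G) {f : X → E} {g : Y → F}
    (hf : Continuous f) (hg : Continuous g) :
    B (∫ x, f x ∂μ) (∫ y, g y ∂ν) = ∫ x, ∫ y, B (f x) (g y) ∂ν ∂μ := by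
  rw [integral_bilin_integral B hf hg, integral_prod _ (integrable_bilin_prod B hf hg)]

/-- THE WEIGHTED FORM (Lemma A as stated): with continuous scalar weights `χ₀`, `χ₁` (the
characters of the two tori) and continuous `θ₀`, `θ₁` (the theta series as maps into the forms),
`B (∫ χ₀ • θ₀) (∫ χ₁ • θ₁) = ∫ (χ₀ z.1 * χ₁ z.2) • B (θ₀ z.1) (θ₁ z.2) d(μ × ν)`. -/
theorem integral_smul_bilin_integral_smul (B : E →L[𝕜] F →L[𝕜] G)
    {χ₀ : X → 𝕜} {χ₁ : Y → 𝕜} {θ₀ : X → E} {θ₁ : Y → F}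
    (hχ₀ : Continuous χ₀) (hχ₁ : Continuous χ₁) (hθ₀ : Continuous θ₀) (hθ₁ : Continuous θ₁) :
    B (∫ x, χ₀ x • θ₀ x ∂μ) (∫ y, χ₁ y • θ₁ y ∂ν) =
      ∫ z, (χ₀ z.1 * χ₁ z.2) • B (θ₀ z.1) (θ₁ z.2) ∂μ.prod ν := by
  have hf : Continuous fun x => χ₀ x • θ₀ x := hχ₀.smul hθ₀
  have hg : Continuous fun y => χ₁ y • θ₁ y := hχ₁.smul hθ₁
  rw [integral_bilin_integral B hf hg]
  simp only [ContinuousLinearMap.map_smul, smul_apply, smul_smul]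

/-- The weighted form as an iterated integral. -/
theorem integral_smul_bilin_integral_smul_iterated (B : E →L[𝕜] F →L[𝕜] G)
    {χ₀ : X → 𝕜} {χ₁ : Y → 𝕜} {θ₀ : X → E} {θ₁ : Y → F}
    (hχ₀ : Continuous χ₀) (hχ₁ : Continuous χ₁) (hθ₀ : Continuous θ₀) (hθ₁ : Continuous θ₁) :
    B (∫ x, χ₀ x • θ₀ x ∂μ) (∫ y, χ₁ y • θ₁ y ∂ν) =
      ∫ x, ∫ y, (χ₀ x * χ₁ y) • B (θ₀ x) (θ₁ y) ∂ν ∂μ := by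
  have hf : Continuous fun x => χ₀ x • θ₀ x := hχ₀.smul hθ₀
  have hg : Continuous fun y => χ₁ y • θ₁ y := hχ₁.smul hθ₁
  rw [integral_bilin_integral_iterated B hf hg]
  simp only [ContinuousLinearMap.map_smul, smul_apply, smul_smul]

end bilinear

section fubini

variable {G : Type*} [NormedAddCommGroup G] [NormedSpace ℝ G]

omit [OpensMeasurableSpace X] [OpensMeasurableSpace Y] in
/-- THE FUBINI STEP OF LEMMA D. A continuous function on a compact product carrying the product
of two finite measures is integrable, and its integral may be computed in either order. -/
theorem integral_prod_eq_iterated_of_continuous [OpensMeasurableSpace (X × Y)]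
    {Φ : X × Y → G} (hΦ : Continuous Φ) :
    (∫ z, Φ z ∂μ.prod ν = ∫ x, ∫ y, Φ (x, y) ∂ν ∂μ) ∧
      ∫ z, Φ z ∂μ.prod ν = ∫ y, ∫ x, Φ (x, y) ∂μ ∂ν := by
  have hint : Integrable Φ (μ.prod ν) := integrable_of_continuous hΦ
  exact ⟨integral_prod Φ hint, integral_prod_symm Φ hint⟩

end fubini

end HodgeRepro.T3P1.WedgeFubini
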